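import Summits.FinalStateConjecture.FinalStateConjecture.Theorems.EIHFluxBalanceInertialRecessionStubQuasiStationarityBound
import Summits.FinalStateConjecture.FinalStateConjecture.Theorems.EIHFluxBalanceInertialRecessionStubSlavingHelpers

/-!
# Route EIHFluxBalance — `InertialRecession`, line `sublinear-is-free-clean-window-charges`:
# the modulation defect of one painted summand (stub `stub_identification`, part A4)

Helper file (`--supports stmt-FinalStateConjecture-10166`) for the crux
`Summit.FinalStateConjecture.FinalStateConjecture.Theses.EIHFluxBalance.InertialRecession`.

The identification compares, on a small sphere about hole `j` at lab time `t`, the lab metric with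
the FROZEN boosted Kerr–Schild field `F(y) = boostedKerrBilin (Λ t) (t, ξ t) M a y` of hole `j`. On
the slice `{y⁰ = t}` the painted summand `S(y) = boostedKerrBilin (Λ(y⁰)) (y⁰, ξ(y⁰)) M a y` and
`F` have the same values and spatial derivatives; they differ only in `∂₀`, and this file bounds that
**modulation defect**: at lab distance `d = ‖x̲ − ξ(t)‖ ≥ max 1 (2|a|)` from the centre,

  `‖D S(x)[e₀] − D F(x)[e₀]‖ ≤ |M| G² ( (B₁G + 2B₀) ν / d + B₁ G ‖ξ̇(t) − v(Λ t)‖ / d² )`, `G = 1 + 3γ`,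

`v(Λ) = (Λe₀)~/(Λe₀)⁰` the painted velocity and `ν` any bound of the stabiliser-corrected body-frame
rate as in `SublinearIsFree.QuasiStationarity.norm_fderiv_summand_basisVector_zero_le` (whose proof
is the template: the frozen field is the summand painted with CONSTANT `Λ` and the INERTIAL centre
`ξ(t) + (s − t)v`, `SublinearIsFree.Slaving.boostedKerrBilin_inertialCentre`, so the two
`ξ̇`-channels subtract to `ξ̇ − v` and the `Λ̇`-channel is unchanged). In particular the defect is
`O(M(‖u̇‖/d + ‖ξ̇ − v‖/d²))` (`exists_stabiliser_correction`): slaved moduli make frozen holes exact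
to first order. [cite: KerrSchild1965, §3]
-/

set_option linter.dupNamespace false

noncomputable section

namespace Summit.FinalStateConjecture.FinalStateConjecture.Theorems.SublinearIsFree.ChargeModel

open scoped BigOperators Topology ContDiff
open Filter Set Function Literature.Geometry.Lorentzian
open Summit.FinalStateConjecture.FinalStateConjecture.Theorems
open Summit.FinalStateConjecture.FinalStateConjecture.Theorems.InertialRecession.Negative
open SublinearIsFree.QuasiStationarity SublinearIsFree.Slaving

-- operator-norm instance paths on form-valued maps are slow to unify
set_option synthInstance.maxHeartbeats 200000 in
/-- **The frozen field is an inertially painted summand**: `boostedKerrBilin (Λ t) (t, ξ t) M a y`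
is the value at `y` of the summand painted with the constant motion `Λ t` and the inertial centre
`s ↦ ξ t + (s − t) v(Λ t)`. [cite: KerrSchild1965, §2] -/
theorem frozen_eq_inertialSummand (Λ : ℝ → lorentzGroup) (ξ : ℝ → E3) (M a t : ℝ) :
    (fun y : E4 ↦ boostedKerrBilin (Λ t) (E4.ofTimeSpace t (ξ t)) M a y - Minkowski.bilin) =
      fun y : E4 ↦ boostedKerrBilin ((fun _ : ℝ ↦ Λ t) (y 0)) (E4.ofTimeSpace (y 0)
        ((fun s : ℝ ↦ ξ t + (s - t) • ((((Λ t : E4 ≃L[ℝ] E4) (E4.basisVector 0)) 0)⁻¹ •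
          E4.spatial ((Λ t : E4 ≃L[ℝ] E4) (E4.basisVector 0)))) (y 0))) M a y - Minkowski.bilin := by
  funext y
  rw [boostedKerrBilin_inertialCentre (Λ t) t (ξ t) M a (y 0) y]

/-- Scalar bookkeeping of the defect estimate: the output of `abs_rate_expansion_le` with the
Kerr–Schild sizes `‖p‖ ≤ G d`, `‖(g−η)(p)‖ ≤ |M|B₀/d`, `δ₁ = |M|B₁/d²`, `‖e‖ ≤ G‖ξ̇ − v‖`,
`‖Av‖ ≤ G‖v‖`, `‖Aw‖ ≤ G‖w‖` (the left side is known to dominate an absolute value, hence is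
nonnegative). [folklore] -/
theorem defect_scalar_bound {M B₀ B₁ G d ν np nK ne nAv nAw nv nw nx X : ℝ} (hB₀ : 0 ≤ B₀)
    (hB₁ : 0 ≤ B₁) (hG : 0 ≤ G) (hd : 0 < d) (hν : 0 ≤ ν) (hnv : 0 ≤ nv) (hnx : 0 ≤ nx) (hnAv : 0 ≤ nAv) (hnAw : 0 ≤ nAw) (hnK : 0 ≤ nK) (hne : 0 ≤ ne) (hnp : 0 ≤ np)
    (hp : np ≤ G * d) (hK : nK ≤ |M| * B₀ / d) (he : ne ≤ G * nx)
    (hAv : nAv ≤ G * nv) (hAw : nAw ≤ G * nw)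
    (hX : X ≤ (|M| * B₁ / d ^ 2 * ν * np + 2 * nK * ν + |M| * B₁ / d ^ 2 * ne) * nAv * nAw) :
    X ≤ |M| * G ^ 2 * ((B₁ * G + 2 * B₀) * ν / d + B₁ * G * nx / d ^ 2) * nv * nw := by
  have hcoef : |M| * B₁ / d ^ 2 * ν * np + 2 * nK * ν + |M| * B₁ / d ^ 2 * ne
      ≤ |M| * ((B₁ * G + 2 * B₀) * ν / d + B₁ * G * nx / d ^ 2) := by
    have h1 : |M| * B₁ / d ^ 2 * ν * np ≤ |M| * B₁ * G * ν / d := by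
      have : |M| * B₁ / d ^ 2 * ν * np ≤ |M| * B₁ / d ^ 2 * ν * (G * d) :=
        mul_le_mul_of_nonneg_left hp (by positivity)
      refine this.trans (le_of_eq ?_)
      field_simp
    have h2 : 2 * nK * ν ≤ 2 * (|M| * B₀ / d) * ν := by gcongr
    have h3 : |M| * B₁ / d ^ 2 * ne ≤ |M| * B₁ / d ^ 2 * (G * nx) :=
      mul_le_mul_of_nonneg_left he (by positivity)
    have hsum := add_le_add (add_le_add h1 h2) h3
    refine hsum.trans (le_of_eq ?_)
    field_simp
  have hcoef0 : 0 ≤ |M| * B₁ / d ^ 2 * ν * np + 2 * nK * ν + |M| * B₁ / d ^ 2 * ne := by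
    positivity
  have hvw : nAv * nAw ≤ G * nv * (G * nw) := mul_le_mul hAv hAw hnAw (by positivity)
  refine hX.trans ?_
  calc (|M| * B₁ / d ^ 2 * ν * np + 2 * nK * ν + |M| * B₁ / d ^ 2 * ne) * nAv * nAw
      ≤ |M| * ((B₁ * G + 2 * B₀) * ν / d + B₁ * G * nx / d ^ 2) * (G * nv * (G * nw)) := by
        rw [mul_assoc]
        exact mul_le_mul hcoef hvw (by positivity) (by positivity)
    _ = |M| * G ^ 2 * ((B₁ * G + 2 * B₀) * ν / d + B₁ * G * nx / d ^ 2) * nv * nw := by ring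

-- operator-norm instance paths on form-valued maps are slow to unify; the chain-rule bookkeeping is long
set_option synthInstance.maxHeartbeats 200000 in
set_option maxHeartbeats 400000 in
/-- **The modulation defect of one painted summand.** With universal constants `B₀, B₁ ≥ 0`: for a
`C¹` motion `Λ` with `|(Λ(t)e₀)⁰| ≤ γ`, a `C¹` centre `ξ`, a slab point `x` (`x⁰ = t`) at lab distance
`d = ‖x̲ − ξ(t)‖ ≥ max 1 (2|a|)`, and a stabiliser correction `SK` of the body-frame rate with
`‖(Λ(t)⁻¹Λ̇(t) − SK)u‖ ≤ ν‖u‖`, the lab-time derivatives of the painted summand and of the frozen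
field `boostedKerrBilin (Λ t) (t, ξ t) M a` at `x` differ by at most
`|M| G² ((B₁G + 2B₀) ν / d + B₁ G ‖ξ̇(t) − v(Λ t)‖ / d²)`, `G = 1 + 3γ`, `v(Λ) = (Λe₀)~/(Λe₀)⁰`.
[cite: KerrSchild1965, §3] -/
theorem norm_fderiv_summand_sub_frozen_basisVector_zero_le :
    ∃ B₀ B₁ : ℝ, 0 ≤ B₀ ∧ 0 ≤ B₁ ∧ ∀ (M a γ : ℝ) (Λ : ℝ → lorentzGroup) (ξ : ℝ → E3) (t : ℝ)
      (x : E4) (SK : E4 →L[ℝ] E4) (ν : ℝ),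
      ContDiff ℝ 1 (fun s ↦ ((Λ s : E4 ≃L[ℝ] E4) : E4 →L[ℝ] E4)) → ContDiff ℝ 1 ξ →
      |((Λ t : E4 ≃L[ℝ] E4) (E4.basisVector 0)) 0| ≤ γ → x 0 = t →
      max 1 (2 * |a|) ≤ ‖E4.spatial x - ξ t‖ → 0 ≤ ν →
      (∀ v w, fderiv ℝ (fun y ↦ Kerr.bilin M a y - Minkowski.bilin)
          ((((Λ t : E4 ≃L[ℝ] E4).symm : E4 →L[ℝ] E4)) (E4.spaceEmbed (E4.spatial x - ξ t)))
          (SK ((((Λ t : E4 ≃L[ℝ] E4).symm : E4 →L[ℝ] E4)) (E4.spaceEmbed (E4.spatial x - ξ t))))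
          v w +
        (Kerr.bilin M a ((((Λ t : E4 ≃L[ℝ] E4).symm : E4 →L[ℝ] E4))
          (E4.spaceEmbed (E4.spatial x - ξ t))) - Minkowski.bilin) (SK v) w +
        (Kerr.bilin M a ((((Λ t : E4 ≃L[ℝ] E4).symm : E4 →L[ℝ] E4))
          (E4.spaceEmbed (E4.spatial x - ξ t))) - Minkowski.bilin) v (SK w) = 0) →
      (∀ u, ‖((((Λ t : E4 ≃L[ℝ] E4).symm : E4 →L[ℝ] E4)).comp
          (deriv (fun s ↦ ((Λ s : E4 ≃L[ℝ] E4) : E4 →L[ℝ] E4)) t) - SK) u‖ ≤ ν * ‖u‖) →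
      ‖fderiv ℝ (fun y : E4 ↦ boostedKerrBilin (Λ (y 0)) (E4.ofTimeSpace (y 0) (ξ (y 0))) M a y -
          Minkowski.bilin) x (E4.basisVector 0) -
        fderiv ℝ (fun y : E4 ↦ boostedKerrBilin (Λ t) (E4.ofTimeSpace t (ξ t)) M a y -
          Minkowski.bilin) x (E4.basisVector 0)‖ ≤
        |M| * (1 + 3 * γ) ^ 2 * ((B₁ * (1 + 3 * γ) + 2 * B₀) * ν / ‖E4.spatial x - ξ t‖ +
          B₁ * (1 + 3 * γ) * ‖deriv ξ t - (((Λ t : E4 ≃L[ℝ] E4) (E4.basisVector 0)) 0)⁻¹ •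
            E4.spatial ((Λ t : E4 ≃L[ℝ] E4) (E4.basisVector 0))‖ / ‖E4.spatial x - ξ t‖ ^ 2) := by
  obtain ⟨B₀, hB₀, hK0⟩ := exists_norm_ksPert_le
  obtain ⟨B₁, hB₁, hK1⟩ := exists_norm_iteratedFDeriv_one_ksPert_le
  refine ⟨B₀, B₁, hB₀, hB₁, ?_⟩
  intro M a γ Λ ξ t x SK ν hΛ hξ hγ hx hd hν0 hstab hν
  -- names
  set Lpath : ℝ → E4 →L[ℝ] E4 := fun s ↦ ((Λ s : E4 ≃L[ℝ] E4) : E4 →L[ℝ] E4) with hLpath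
  set Apath : ℝ → E4 →L[ℝ] E4 := fun s ↦ (((Λ s : E4 ≃L[ℝ] E4).symm : E4 →L[ℝ] E4)) with hApath
  set A : E4 →L[ℝ] E4 := (((Λ t : E4 ≃L[ℝ] E4).symm : E4 →L[ℝ] E4)) with hAdef
  set L' : E4 →L[ℝ] E4 := deriv Lpath t with hL'
  set K : E4 → E4 →L[ℝ] E4 →L[ℝ] ℝ := fun y ↦ Kerr.bilin M a y - Minkowski.bilin with hKdef
  set z : E3 := E4.spatial x with hz
  set vel : E3 := (((Λ t : E4 ≃L[ℝ] E4) (E4.basisVector 0)) 0)⁻¹ •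
    E4.spatial ((Λ t : E4 ≃L[ℝ] E4) (E4.basisVector 0)) with hvel
  set ξin : ℝ → E3 := fun s ↦ ξ t + (s - t) • vel with hξin
  set d : ℝ := ‖z - ξ t‖ with hddef
  set p : E4 := A (E4.spaceEmbed (z - ξ t)) with hpdef
  set G : ℝ := 1 + 3 * γ with hG
  -- sizes
  have hγ1 : 1 ≤ γ := (one_le_abs_lorentz_apply_zero (Λ t)).trans hγ
  have hG0 : 0 ≤ G := by rw [hG]; linarith
  have hAG : ‖A‖ ≤ G := (norm_lorentz_symm_le' (Λ t)).trans (by rw [hG]; linarith)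
  have hd1 : 1 ≤ d := (le_max_left _ _).trans hd
  have hd0 : 0 < d := one_pos.trans_le hd1
  have hσ : d ≤ E4.spatialNorm p := le_spatialNorm_restPosition (Λ t) _
  have hσ0 : 0 < E4.spatialNorm p := hd0.trans_le hσ
  have hσ' : max 1 (2 * |a|) ≤ E4.spatialNorm p := hd.trans hσ
  have hp : ‖p‖ ≤ G * d := by
    rw [hpdef]
    refine (A.le_opNorm _).trans ?_
    rw [norm_spaceEmbed]
    exact mul_le_mul_of_nonneg_right hAG (norm_nonneg _)
  -- derivatives of the paths
  have hΛ' : HasDerivAt Lpath L' t := (hΛ.differentiable one_ne_zero t).hasDerivAt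
  have hA : HasDerivAt Apath (-(A.comp (L'.comp A))) t := hasDerivAt_lorentz_symm one_ne_zero hΛ hΛ'
  have hξ' : HasDerivAt ξ (deriv ξ t) t := (hξ.differentiable one_ne_zero t).hasDerivAt
  have hKdiff : DifferentiableAt ℝ K p := differentiableAt_ksPert_of_le hσ'
  -- the inertial painting: constant motion, centre `ξin`
  have hξin_t : ξin t = ξ t := by simp [hξin]
  have hξin_c : ContDiff ℝ 1 ξin :=
    contDiff_const.add ((contDiff_id.sub contDiff_const).smul contDiff_const)
  have hξin' : HasDerivAt ξin vel t := by
    have h := (((hasDerivAt_id t).sub_const t).smul_const vel).const_add (ξ t)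
    simpa [hξin] using h
  have hΛc : ContDiff ℝ 1 (fun _ : ℝ ↦ ((Λ t : E4 ≃L[ℝ] E4) : E4 →L[ℝ] E4)) := contDiff_const
  have hdin : max 1 (2 * |a|) ≤ ‖E4.spatial x - ξin t‖ := by rwa [hξin_t]
  -- Kerr–Schild decay at the rest-frame point
  have hK0p : ‖K p‖ ≤ |M| * B₀ / d := by
    refine (hK0 M a p hσ').trans ?_
    exact div_le_div_of_nonneg_left (by positivity) hd0 hσ
  have hK1p : ‖iteratedFDeriv ℝ 1 K p‖ ≤ |M| * B₁ / d ^ 2 := by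
    refine (hK1 M a p hσ').trans ?_
    exact div_le_div_of_nonneg_left (by positivity) (by positivity)
      (pow_le_pow_left₀ hd0.le hσ 2)
  have hδ₁ : ∀ u, ‖fderiv ℝ K p u‖ ≤ |M| * B₁ / d ^ 2 * ‖u‖ := fun u ↦
    (norm_fderiv_apply_le_of_iteratedFDeriv_one K p u).trans
      (mul_le_mul_of_nonneg_right hK1p (norm_nonneg u))
  -- both fields are differentiable at `x`
  have hS := (contDiffAt_summand (M := M) (a := a) hΛ hξ hx hd).differentiableAt one_ne_zero
  have hF := (contDiffAt_summand (M := M) (a := a) (Λ := fun _ : ℝ ↦ Λ t) (ξ := ξin) hΛc hξin_c hx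
    hdin).differentiableAt one_ne_zero
  -- pointwise bound on the difference
  set C : ℝ := |M| * G ^ 2 * ((B₁ * G + 2 * B₀) * ν / d + B₁ * G * ‖deriv ξ t - vel‖ / d ^ 2) with hC
  have hC0 : 0 ≤ C := by positivity
  rw [frozen_eq_inertialSummand Λ ξ M a t]
  refine ContinuousLinearMap.opNorm_le_bound₂ _ hC0 fun v w ↦ ?_
  rw [_root_.sub_apply, _root_.sub_apply]
  -- the two scalar families and their derivatives
  have hδS := hasDerivAt_restFrame_scalar M a hA hξ' z hKdiff v w
  have heqS := fderiv_summand_basisVector_zero_apply hx hS v w hδS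
  have hKdiff' : DifferentiableAt ℝ K ((fun _ : ℝ ↦ A) t (E4.spaceEmbed (z - ξin t))) := by
    rw [hξin_t]
    exact hKdiff
  have hδF := hasDerivAt_restFrame_scalar M a (A := fun _ : ℝ ↦ A) (A' := 0)
    (hasDerivAt_const t A) hξin' z hKdiff' v w
  have heqF := fderiv_summand_basisVector_zero_apply (Λ := fun _ : ℝ ↦ Λ t) (ξ := ξin) hx hF v w
    (by simpa only [hξin_t] using hδF)
  rw [Real.norm_eq_abs, heqS, heqF]
  simp only [_root_.zero_apply, map_zero, zero_add, add_zero]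
  -- rewrite `A' u = −ω(Au)` with `ω = A Λ̇`
  set W : E4 →L[ℝ] E4 := A.comp L' with hW
  have hA'u : ∀ u, (-(A.comp (L'.comp A))) u = -(W (A u)) := fun u ↦ by
    simp [hW]
  have hlin : fderiv ℝ (fun y ↦ Kerr.bilin M a y - Minkowski.bilin) (A (E4.spaceEmbed (z - ξ t)))
        ((-(A.comp (L'.comp A))) (E4.spaceEmbed (z - ξ t)) + Apath t (E4.spaceEmbed (-deriv ξ t)))
        (A v) (A w) +
      (Kerr.bilin M a (A (E4.spaceEmbed (z - ξ t))) - Minkowski.bilin) ((-(A.comp (L'.comp A))) v)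
        (A w) +
      (Kerr.bilin M a (A (E4.spaceEmbed (z - ξ t))) - Minkowski.bilin) (A v)
        ((-(A.comp (L'.comp A))) w) -
      fderiv ℝ (fun y ↦ Kerr.bilin M a y - Minkowski.bilin) (A (E4.spaceEmbed (z - ξ t)))
        (A (E4.spaceEmbed (-vel))) (A v) (A w) =
      fderiv ℝ K p (-(W p) + -(A (E4.spaceEmbed (deriv ξ t - vel)))) (A v) (A w) +
        K p (-(W (A v))) (A w) + K p (A v) (-(W (A w))) := by
    rw [hA'u, hA'u, hA'u]
    have h1 : Apath t (E4.spaceEmbed (-deriv ξ t)) = -(A (E4.spaceEmbed (deriv ξ t))) := by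
      rw [map_neg, map_neg]
    have h2 : A (E4.spaceEmbed (-vel)) = -(A (E4.spaceEmbed vel)) := by rw [map_neg, map_neg]
    rw [h1, h2, map_sub, map_sub]
    simp only [map_add, map_neg, map_sub, _root_.add_apply,
      _root_.neg_apply, _root_.sub_apply, hKdef, hpdef]
    ring
  rw [hlin]
  have key := abs_rate_expansion_le (fderiv ℝ K p) (K p) W SK p (A (E4.spaceEmbed (deriv ξ t - vel)))
    (A v) (A w) hδ₁ hν (by positivity) (hstab (A v) (A w))
  -- sizes of the pieces
  have hAv : ‖A v‖ ≤ G * ‖v‖ := (A.le_opNorm v).trans (mul_le_mul_of_nonneg_right hAG (norm_nonneg _))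
  have hAw : ‖A w‖ ≤ G * ‖w‖ := (A.le_opNorm w).trans (mul_le_mul_of_nonneg_right hAG (norm_nonneg _))
  have he : ‖A (E4.spaceEmbed (deriv ξ t - vel))‖ ≤ G * ‖deriv ξ t - vel‖ := by
    refine (A.le_opNorm _).trans ?_
    rw [norm_spaceEmbed]
    exact mul_le_mul_of_nonneg_right hAG (norm_nonneg _)
  clear_value C G p d vel K W A L' z
  rw [hC]
  exact defect_scalar_bound (nK := ‖K p‖) hB₀ hB₁ hG0 hd0 hν0 (norm_nonneg v) (norm_nonneg _)
    (norm_nonneg _) (norm_nonneg _) (norm_nonneg (K p)) (norm_nonneg _) (norm_nonneg _) hp hK0p he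
    hAv hAw key

-- operator-norm instance paths on form-valued maps are slow to unify
set_option synthInstance.maxHeartbeats 200000 in
/-- Registered sub-goal form (stub `ll_painted_summand_defect_bound` of the crux item) of
`norm_fderiv_summand_sub_frozen_basisVector_zero_le`: the modulation defect of one painted summand is
linear in the slaving rates (Kerr–Schild 1965, §3). [cite: KerrSchild1965, §3] -/
theorem ll_painted_summand_defect_bound : open Literature.Geometry.Lorentzian in ∃ B₀ B₁ : ℝ, 0 ≤ B₀ ∧ 0 ≤ B₁ ∧ ∀ (M a γ : ℝ) (Λ : ℝ → lorentzGroup) (ξ : ℝ → E3) (t : ℝ) (x : E4) (SK : E4 →L[ℝ] E4) (ν : ℝ), ContDiff ℝ 1 (fun s ↦ ((Λ s : E4 ≃L[ℝ] E4) : E4 →L[ℝ] E4)) → ContDiff ℝ 1 ξ → |((Λ t : E4 ≃L[ℝ] E4) (E4.basisVector 0)) 0| ≤ γ → x 0 = t → max 1 (2 * |a|) ≤ ‖E4.spatial x - ξ t‖ → 0 ≤ ν → (∀ v w, fderiv ℝ (fun y ↦ Kerr.bilin M a y - Minkowski.bilin) ((((Λ t : E4 ≃L[ℝ] E4).symm :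 E4 →L[ℝ] E4)) (E4.spaceEmbed (E4.spatial x - ξ t))) (SK ((((Λ t : E4 ≃L[ℝ] E4).symm : E4 →L[ℝ] E4)) (E4.spaceEmbed (E4.spatial x - ξ t)))) v w + (Kerr.bilin M a ((((Λ t : E4 ≃L[ℝ] E4).symm : E4 →L[ℝ] E4)) (E4.spaceEmbed (E4.spatial x - ξ t))) - Minkowski.bilin) (SK v) w + (Kerr.bilin M a ((((Λ t : E4 ≃L[ℝ] E4).symm : E4 →L[ℝ] E4)) (E4.spaceEmbed (E4.spatial x - ξ t))) - Minkowski.bilin) v (SK w) = 0) → (∀ u, ‖((((Λ t : E4 ≃L[ℝ] E4).symm : E4 →L[ℝ] E4)).comp (deriv (fun s ↦ ((Λ s : E4 ≃L[ℝ] E4) : E4 →L[ℝ] E4)) t) - SK) u‖ ≤ ν * ‖u‖) → ‖fderiv ℝ (fun y : E4 ↦ boostedKerrBilin (Λ (y 0)) (E4.ofTimeSpace (y 0) (ξ (y 0))) M a y - Minkowski.bilin) x (E4.basisVector 0) - fderiv ℝ (fun y : E4 ↦ boostedKerrBilin (Λ t) (E4.ofTimeSpace t (ξ t)) M a y - Minkowski.bilin)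 x (E4.basisVector 0)‖ ≤ |M| * (1 + 3 * γ) ^ 2 * ((B₁ * (1 + 3 * γ) + 2 * B₀) * ν / ‖E4.spatial x - ξ t‖ + B₁ * (1 + 3 * γ) * ‖deriv ξ t - (((Λ t : E4 ≃L[ℝ] E4) (E4.basisVector 0)) 0)⁻¹ • E4.spatial ((Λ t : E4 ≃L[ℝ] E4) (E4.basisVector 0))‖ / ‖E4.spatial x - ξ t‖ ^ 2) :=
  norm_fderiv_summand_sub_frozen_basisVector_zero_le

end Summit.FinalStateConjecture.FinalStateConjecture.Theorems.SublinearIsFree.ChargeModel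

end
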